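import Summits.AtomisticToContinuum.BoseEinsteinCondensation.Theorems.BECInsertionCorrectorStaticResponseBoundTruncationCompactness
import Literature.MathematicalPhysics.QuantumManyBody.PeriodicMaxFormBound
import Literature.MathematicalPhysics.QuantumManyBody.PeriodicFormSpectrum
import HarnessLib

/-!
# Crux `PeriodicIRBound` (stmt-AtomisticToContinuum-3972), line `linear-ph-floor-wagner` — monotone
# convergence of the periodic ground-state energy along a GENERAL increasing family of profiles

Helper file of the line lead (seat c2). The sibling crux `StaticResponseBound` proves the compactness half
of the truncation limit `E₀(min(v,n)) ↑ E₀(v)` for the HEIGHT truncations `truncPotential v n`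
(`exists_limitProfile`, Rellich + Fatou + Beppo Levi through the free form domain). For measurable INTEGRABLE
profiles of infinite range the height truncations have unbounded periodisations, so the Perron–Frobenius
argument of this line (`…PFOpNorm.lean`) needs the same statement along an arbitrary increasing family
`w₀ ≤ w₁ ≤ … ↑ v` of measurable profiles (used with the height-and-range truncations
`1_{[0,n]}·min(v,n)`, each of finite range and bounded). This file runs the proof of `exists_limitProfile`
verbatim for such a family:

* `monotone_periodizedPotential_family`, `iSup_periodizedPotential_family`, `monotone_periodicInteraction_family`,
  `iSup_periodicInteraction_family`, `monotone_periodicEnergy_family`, `periodicEnergy_family_le`,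
  `monotone_periodicGroundStateEnergy_family`, `periodicGroundStateEnergy_family_le` — pointwise monotone
  convergence of the periodised potentials, interactions and energies;
* `exists_limitProfile_family` — the compactness half: a unit Bose-symmetric `η ∈ L²((ℝ/ℤ)^{3N})` with
  maximal-form `v`-energy `≤ ⨆ₙ E₀(wₙ)`;
* `iSup_periodicGroundStateEnergy_family` — **`⨆ₙ E₀(wₙ) = E₀(v)`** for `N ≥ 1`, `L > 0` and an integrable
  interaction (Simon's maximal-form bound `periodicGroundStateEnergy_le_maxForm`).

References: Reed–Simon IV Thm XIII.64; B. Simon, J. Funct. Anal. 28 (1978) 377 (monotone convergence of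
forms); B. Simon, J. Operator Theory 1 (1979) 37.
-/

noncomputable section

namespace Summit.AtomisticToContinuum.BoseEinsteinCondensation.Cruxes.PeriodicIRBound.LinearPhFloorWagner

open MeasureTheory Filter UnitAddTorus
open scoped ENNReal NNReal BigOperators Topology InnerProductSpace
open Literature.MathematicalPhysics.QuantumManyBody.BoseGas
open Summit.AtomisticToContinuum.BoseEinsteinCondensation.Cruxes.StaticResponseBound.UvThomsonForceWave

-- The measure on `ℝ/ℤ` is the Haar PROBABILITY measure, as in `PeriodicFormDomain.lean` (whose local
-- instances we re-activate, so that `Lp ℂ 2 volume` below is literally the target of `formEmbed`).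
attribute [local instance] Literature.MathematicalPhysics.QuantumManyBody.BoseGas.formDomain_measureSpace
  Literature.MathematicalPhysics.QuantumManyBody.BoseGas.formDomain_isProbabilityMeasure
  Literature.MathematicalPhysics.QuantumManyBody.BoseGas.formDomain_isProbabilityMeasure_pi

variable {N : ℕ} {L : ℝ} {v : ℝ → ℝ≥0∞} {w : ℕ → ℝ → ℝ≥0∞}

/-! ### Pointwise monotone convergence along the family -/

/-- The periodised potentials increase along an increasing family of profiles. [folklore] -/
theorem monotone_periodizedPotential_family (hmono : ∀ r, Monotone fun n => w n r) (L : ℝ) (x : Space) :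
    Monotone fun n : ℕ => periodizedPotential (w n) L x :=
  fun _ _ h => ENNReal.tsum_le_tsum fun _ => hmono _ h

/-- `⨆ₙ (wₙ)^per = v^per` pointwise when `wₙ ↑ v` pointwise. [folklore] -/
theorem iSup_periodizedPotential_family (hmono : ∀ r, Monotone fun n => w n r) (hsup : ∀ r, ⨆ n, w n r = v r)
    (L : ℝ) (x : Space) : ⨆ n : ℕ, periodizedPotential (w n) L x = periodizedPotential v L x := by
  unfold periodizedPotential
  refine le_antisymm (iSup_le fun n => ENNReal.tsum_le_tsum fun m => ?_) ?_
  · rw [← hsup]; exact le_iSup (fun n => w n _) n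
  calc ∑' m : Fin 3 → ℤ, v ‖x - latticeVec L m‖
      = ∑' m : Fin 3 → ℤ, ⨆ n : ℕ, w n ‖x - latticeVec L m‖ := tsum_congr fun m => (hsup _).symm
    _ = ⨆ s : Finset (Fin 3 → ℤ), ∑ m ∈ s, ⨆ n : ℕ, w n ‖x - latticeVec L m‖ := ENNReal.tsum_eq_iSup_sum
    _ ≤ ⨆ n : ℕ, ∑' m : Fin 3 → ℤ, w n ‖x - latticeVec L m‖ := by
        refine iSup_le fun s => ?_
        rw [ENNReal.finsetSum_iSup_of_monotone (f := fun m n => w n ‖x - latticeVec L m‖) fun m => hmono _]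
        exact iSup_mono fun n => ENNReal.sum_le_tsum s

/-- The periodic interactions increase along the family. [folklore] -/
theorem monotone_periodicInteraction_family (hmono : ∀ r, Monotone fun n => w n r) (L : ℝ) (X : Config N) :
    Monotone fun n : ℕ => periodicInteraction (w n) L X :=
  fun _ _ h => Finset.sum_le_sum fun _ _ => Finset.sum_le_sum fun _ _ =>
    monotone_periodizedPotential_family hmono L _ h

/-- `⨆ₙ Wₙ = W` pointwise along the family. [folklore] -/
theorem iSup_periodicInteraction_family (hmono : ∀ r, Monotone fun n => w n r) (hsup : ∀ r, ⨆ n, w n r = v r)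
    (L : ℝ) (X : Config N) : ⨆ n : ℕ, periodicInteraction (w n) L X = periodicInteraction v L X := by
  have hin : ∀ i : Fin N, Monotone fun n : ℕ =>
      ∑ j : Fin N with i < j, periodizedPotential (w n) L (X i - X j) :=
    fun i _ _ h => Finset.sum_le_sum fun j _ => monotone_periodizedPotential_family hmono L _ h
  unfold periodicInteraction
  rw [← ENNReal.finsetSum_iSup_of_monotone hin]
  refine Finset.sum_congr rfl fun i _ => ?_
  rw [← ENNReal.finsetSum_iSup_of_monotone fun j => monotone_periodizedPotential_family hmono L (X i - X j)]
  exact Finset.sum_congr rfl fun j _ => iSup_periodizedPotential_family hmono hsup L _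

/-- The energies of a fixed trial state increase along the family. [folklore] -/
theorem monotone_periodicEnergy_family (hmono : ∀ r, Monotone fun n => w n r) (Ψ : PeriodicTrialState N L) :
    Monotone fun n : ℕ => periodicEnergy (w n) Ψ := by
  intro n n' h
  refine lintegral_mono fun X => ?_
  dsimp only
  gcongr
  exact monotone_periodicInteraction_family hmono L X h

/-- `E_{wₙ}[Ψ] ≤ E_v[Ψ]` along the family. [folklore] -/
theorem periodicEnergy_family_le (hmono : ∀ r, Monotone fun n => w n r) (hsup : ∀ r, ⨆ n, w n r = v r) (n : ℕ)
    (Ψ : PeriodicTrialState N L) : periodicEnergy (w n) Ψ ≤ periodicEnergy v Ψ := by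
  refine lintegral_mono fun X => ?_
  dsimp only
  gcongr
  rw [← iSup_periodicInteraction_family hmono hsup L X]
  exact le_iSup (fun n => periodicInteraction (w n) L X) n

/-- The ground-state energies increase along the family. [folklore] -/
theorem monotone_periodicGroundStateEnergy_family (hmono : ∀ r, Monotone fun n => w n r) (N : ℕ) (L : ℝ) :
    Monotone fun n : ℕ => periodicGroundStateEnergy (w n) N L :=
  fun _ _ h => iInf_mono fun Ψ => monotone_periodicEnergy_family hmono Ψ h

/-- `E₀(wₙ) ≤ E₀(v)` along the family. [folklore] -/
theorem periodicGroundStateEnergy_family_le (hmono : ∀ r, Monotone fun n => w n r) (hsup : ∀ r, ⨆ n, w n r = v r)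
    (n N : ℕ) (L : ℝ) : periodicGroundStateEnergy (w n) N L ≤ periodicGroundStateEnergy v N L :=
  iInf_mono fun Ψ => periodicEnergy_family_le hmono hsup n Ψ

/-! ### The compactness half along the family -/

/-- **Compactness half of the monotone form limit along an increasing family (Rellich + Fatou + Beppo Levi).**
For measurable profiles `w₀ ≤ w₁ ≤ … ↑ v` (pointwise) whose periodic ground-state energies stay bounded there is
a unit vector `η ∈ L²((ℝ/ℤ)^{3N})`, Bose-symmetric in momentum space, whose MAXIMAL-form `v`-energy is at most
`⨆ₙ E₀(wₙ)` — verbatim the proof of `exists_limitProfile` (the case `wₙ = min(v, n)`).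
[cite: ReedSimonIV1978, Thm. XIII.64] -/
theorem exists_limitProfile_family (hwm : ∀ n, Measurable (w n)) (hmono : ∀ r, Monotone fun n => w n r)
    (hsup : ∀ r, ⨆ n, w n r = v r) (hL : 0 < L) (hE : ⨆ n, periodicGroundStateEnergy (w n) N L ≠ ⊤) :
    ∃ η : Lp ℂ 2 (volume : Measure (UnitAddTorus (Fin N × Fin 3))), ‖η‖ = 1 ∧
      (∀ (σ : Equiv.Perm (Fin N)) (n : Fin N × Fin 3 → ℤ),
        ⟪(mFourierLp 2 (fun p : Fin N × Fin 3 => n (σ p.1, p.2)) :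
            Lp ℂ 2 (volume : Measure (UnitAddTorus (Fin N × Fin 3)))), η⟫_ℂ =
          ⟪(mFourierLp 2 n : Lp ℂ 2 (volume : Measure (UnitAddTorus (Fin N × Fin 3)))), η⟫_ℂ) ∧
      ∑' n : Fin N × Fin 3 → ℤ, ENNReal.ofReal (∑ p, (2 * Real.pi * (n p : ℝ) / L) ^ 2) *
          (‖⟪(mFourierLp 2 n : Lp ℂ 2 (volume : Measure (UnitAddTorus (Fin N × Fin 3)))), η⟫_ℂ‖₊ :
            ℝ≥0∞) ^ 2 +
        ∫⁻ t, periodicInteraction v L (fromUnitTorusN L t) *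
          (‖(η : UnitAddTorus (Fin N × Fin 3) → ℂ) t‖₊ : ℝ≥0∞) ^ 2 ≤
      ⨆ n, periodicGroundStateEnergy (w n) N L := by
  set Einf : ℝ≥0∞ := ⨆ n, periodicGroundStateEnergy (w n) N L with hEinf
  have hEle : ∀ n, periodicGroundStateEnergy (w n) N L ≤ Einf := fun n =>
    le_iSup (fun n => periodicGroundStateEnergy (w n) N L) n
  -- near-minimisers `Ψ n` of the truncated problems
  set δ : ℕ → ℝ≥0∞ := fun n => ((n + 1 : ℕ) : ℝ≥0∞)⁻¹ with hδ
  have hδpos : ∀ n, 0 < δ n := fun n => ENNReal.inv_pos.2 (ENNReal.natCast_ne_top _)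
  have hδle : ∀ n, δ n ≤ 1 := fun n => ENNReal.inv_le_one.2 (by exact_mod_cast Nat.succ_pos n)
  have hδlim : Tendsto δ atTop (𝓝 0) :=
    ENNReal.tendsto_inv_nat_nhds_zero.comp (tendsto_add_atTop_nat 1)
  have hΨex : ∀ n, ∃ Ψ : PeriodicTrialState N L, periodicEnergy (w n) Ψ < Einf + δ n :=
    fun n => iInf_lt_iff.1 ((hEle n).trans_lt (ENNReal.lt_add_right hE (hδpos n).ne'))
  choose Ψ hΨ using hΨex
  -- the FREE form domain as a compactness device
  set g : ℕ → formDomain hL measurable_zeroProfile (lintegral_periodicInteraction_zero_ne_top N L) :=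
    fun n => ⟨graphEmbed hL measurable_zeroProfile (lintegral_periodicInteraction_zero_ne_top N L)
      ⟨(Ψ n).ψ, (Ψ n).mem_periodicCore⟩, graphEmbed_mem_formDomain _ _ _ _⟩ with hg
  set f : ℕ → Lp ℂ 2 (volume : Measure (UnitAddTorus (Fin N × Fin 3))) := fun n =>
    formEmbed hL measurable_zeroProfile (lintegral_periodicInteraction_zero_ne_top N L) (g n) with hf
  have hf1 : ∀ n, ‖f n‖ = 1 := fun n =>
    norm_formEmbed_graphEmbed_trialState hL measurable_zeroProfile
      (lintegral_periodicInteraction_zero_ne_top N L) (Ψ n)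
  have hkin_le : ∀ n, ∫⁻ X in cellN N L, kineticDensity (Ψ n).ψ X ≤ Einf + 1 := fun n =>
    ((Summit.AtomisticToContinuum.BoseEinsteinCondensation.Cruxes.StaticResponseBound.UvThomsonForceWave.lintegral_kineticDensity_le_periodicEnergy
      _ (Ψ n)).trans (hΨ n).le).trans
      (add_le_add le_rfl (hδle n))
  have hgn : ∀ n, ‖g n‖ ^ 2 ≤ 2 + Einf.toReal := fun n => by
    have h1 : ‖g n‖ = ‖graphEmbed hL measurable_zeroProfile (lintegral_periodicInteraction_zero_ne_top N L)
        ⟨(Ψ n).ψ, (Ψ n).mem_periodicCore⟩‖ := rfl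
    rw [h1, norm_graphEmbed_sq_trialState, periodicEnergy_zero_eq]
    have h2 : (∫⁻ X in cellN N L, kineticDensity (Ψ n).ψ X).toReal ≤ (Einf + 1).toReal :=
      ENNReal.toReal_mono (ENNReal.add_ne_top.2 ⟨hE, ENNReal.one_ne_top⟩) (hkin_le n)
    rw [ENNReal.toReal_add hE ENNReal.one_ne_top, ENNReal.toReal_one] at h2
    linarith
  -- Rellich: an `L²`-convergent subsequence of the embedded near-minimisers
  set R : ℝ := Real.sqrt (2 + Einf.toReal) + 1 with hR
  have hball : ∀ n, g n ∈ Metric.ball (0 : formDomain hL measurable_zeroProfile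
      (lintegral_periodicInteraction_zero_ne_top N L)) R := fun n => by
    rw [Metric.mem_ball, dist_zero_right]
    have h := Real.abs_le_sqrt (hgn n)
    rw [abs_of_nonneg (norm_nonneg _)] at h
    linarith
  have hK : IsCompact (closure ((formEmbed hL measurable_zeroProfile
      (lintegral_periodicInteraction_zero_ne_top N L)) '' Metric.ball 0 R)) :=
    (isCompactOperator_formEmbed hL measurable_zeroProfile
      (lintegral_periodicInteraction_zero_ne_top N L)).isCompact_closure_image_ball
      (f := (formEmbed hL measurable_zeroProfile (lintegral_periodicInteraction_zero_ne_top N L) :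
        formDomain hL measurable_zeroProfile (lintegral_periodicInteraction_zero_ne_top N L) →ₗ[ℂ]
          Lp ℂ 2 (volume : Measure (UnitAddTorus (Fin N × Fin 3))))) R
  obtain ⟨η, -, φ, hφ, hconv⟩ := hK.tendsto_subseq (x := f) fun n => subset_closure ⟨g n, hball n, rfl⟩
  -- an a.e.-convergent further subsequence
  obtain ⟨ns, hns, hae⟩ := (tendstoInMeasure_of_tendsto_Lp hconv).exists_seq_tendsto_ae
  set ψ : ℕ → ℕ := φ ∘ ns with hψdef
  have hψ : StrictMono ψ := hφ.comp hns
  have hconvψ : Tendsto (fun i => f (ψ i)) atTop (𝓝 η) := hconv.comp hns.tendsto_atTop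
  have haeψ : ∀ᵐ t ∂(volume : Measure (UnitAddTorus (Fin N × Fin 3))),
      Tendsto (fun i => (f (ψ i) : UnitAddTorus (Fin N × Fin 3) → ℂ) t) atTop
        (𝓝 ((η : UnitAddTorus (Fin N × Fin 3) → ℂ) t)) := hae
  refine ⟨η, ?_, ?_, ?_⟩
  · -- `‖η‖ = 1`
    have h1 : Tendsto (fun i => ‖f (ψ i)‖) atTop (𝓝 ‖η‖) := (continuous_norm.tendsto η).comp hconvψ
    simp only [hf1] at h1
    exact tendsto_nhds_unique h1 tendsto_const_nhds
  · -- Bose symmetry in momentum space passes to the limit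
    intro σ n
    have hc : ∀ m : Fin N × Fin 3 → ℤ, Continuous fun x : Lp ℂ 2 (volume : Measure (UnitAddTorus (Fin N × Fin 3))) =>
        ⟪(mFourierLp 2 m : Lp ℂ 2 (volume : Measure (UnitAddTorus (Fin N × Fin 3)))), x⟫_ℂ :=
      fun m => continuous_const.inner continuous_id
    have h1 := ((hc (fun p : Fin N × Fin 3 => n (σ p.1, p.2))).tendsto η).comp hconvψ
    have h2 := ((hc n).tendsto η).comp hconvψ
    have h12 : (fun x : Lp ℂ 2 (volume : Measure (UnitAddTorus (Fin N × Fin 3))) =>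
        ⟪(mFourierLp 2 (fun p : Fin N × Fin 3 => n (σ p.1, p.2)) :
          Lp ℂ 2 (volume : Measure (UnitAddTorus (Fin N × Fin 3)))), x⟫_ℂ) ∘ (fun i => f (ψ i)) =
        (fun x : Lp ℂ 2 (volume : Measure (UnitAddTorus (Fin N × Fin 3))) =>
          ⟪(mFourierLp 2 n : Lp ℂ 2 (volume : Measure (UnitAddTorus (Fin N × Fin 3)))), x⟫_ℂ) ∘
            (fun i => f (ψ i)) := by
      funext i
      simp only [Function.comp_apply, hf]
      rw [inner_mFourierLp_formEmbed_trialState, inner_mFourierLp_formEmbed_trialState,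
        configFourierCoeff_perm (Ψ (ψ i)).symm]
    rw [h12] at h1
    exact tendsto_nhds_unique h1 h2
  · -- the energy bound, first at each member `m` of the family
    have hm : ∀ m : ℕ,
        ∑' n : Fin N × Fin 3 → ℤ, ENNReal.ofReal (∑ p, (2 * Real.pi * (n p : ℝ) / L) ^ 2) *
            (‖⟪(mFourierLp 2 n : Lp ℂ 2 (volume : Measure (UnitAddTorus (Fin N × Fin 3)))), η⟫_ℂ‖₊ :
              ℝ≥0∞) ^ 2 +
          ∫⁻ t, periodicInteraction (w m) L (fromUnitTorusN L t) *
            (‖(η : UnitAddTorus (Fin N × Fin 3) → ℂ) t‖₊ : ℝ≥0∞) ^ 2 ≤ Einf := by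
      intro m
      have hWm : Measurable (periodicInteraction (N := N) (w m) L) := measurable_periodicInteraction_trunc (hwm m) L
      -- lower semicontinuity of the kinetic energy
      have hkin : ∑' n : Fin N × Fin 3 → ℤ, ENNReal.ofReal (∑ p, (2 * Real.pi * (n p : ℝ) / L) ^ 2) *
            (‖⟪(mFourierLp 2 n : Lp ℂ 2 (volume : Measure (UnitAddTorus (Fin N × Fin 3)))), η⟫_ℂ‖₊ :
              ℝ≥0∞) ^ 2 ≤
          liminf (fun i => ∫⁻ X in cellN N L, kineticDensity (Ψ (ψ i)).ψ X) atTop := by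
        have h := tsum_mul_inner_sq_le_liminf
          (fun n : Fin N × Fin 3 → ℤ => (mFourierLp 2 n : Lp ℂ 2 (volume : Measure (UnitAddTorus (Fin N × Fin 3)))))
          (w := fun n : Fin N × Fin 3 → ℤ => ENNReal.ofReal (∑ p, (2 * Real.pi * (n p : ℝ) / L) ^ 2))
          (fun _ => ENNReal.ofReal_ne_top) hconvψ
        refine h.trans_eq ?_
        congr 1
        funext i
        exact tsum_kinetic_formEmbed_trialState hL (Ψ (ψ i))
      -- Fatou for the potential energy of the member `m`
      have hpot : ∫⁻ t, periodicInteraction (w m) L (fromUnitTorusN L t) *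
            (‖(η : UnitAddTorus (Fin N × Fin 3) → ℂ) t‖₊ : ℝ≥0∞) ^ 2 ≤
          liminf (fun i => ∫⁻ X in cellN N L, periodicInteraction (w m) L X *
            (‖(Ψ (ψ i)).ψ X‖₊ : ℝ≥0∞) ^ 2) atTop := by
        calc ∫⁻ t, periodicInteraction (w m) L (fromUnitTorusN L t) *
              (‖(η : UnitAddTorus (Fin N × Fin 3) → ℂ) t‖₊ : ℝ≥0∞) ^ 2
            ≤ ∫⁻ t, liminf (fun i => periodicInteraction (w m) L (fromUnitTorusN L t) *
                (‖(f (ψ i) : UnitAddTorus (Fin N × Fin 3) → ℂ) t‖₊ : ℝ≥0∞) ^ 2) atTop := by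
              refine lintegral_mono_ae (haeψ.mono fun t ht => ?_)
              have hsq : Tendsto (fun i => (‖(f (ψ i) : UnitAddTorus (Fin N × Fin 3) → ℂ) t‖₊ : ℝ≥0∞) ^ 2)
                  atTop (𝓝 ((‖(η : UnitAddTorus (Fin N × Fin 3) → ℂ) t‖₊ : ℝ≥0∞) ^ 2)) :=
                ((ENNReal.continuous_pow 2).tendsto _).comp
                  ((ENNReal.continuous_coe.tendsto _).comp ht.nnnorm)
              rw [← hsq.liminf_eq]
              exact mul_liminf_le _ _
          _ ≤ liminf (fun i => ∫⁻ t, periodicInteraction (w m) L (fromUnitTorusN L t) *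
                (‖(f (ψ i) : UnitAddTorus (Fin N × Fin 3) → ℂ) t‖₊ : ℝ≥0∞) ^ 2) atTop :=
              lintegral_liminf_le' fun i => ((hWm.comp (measurable_fromUnitTorusN L)).aemeasurable.mul
                ((Lp.aestronglyMeasurable (f (ψ i))).aemeasurable.nnnorm.coe_nnreal_ennreal.pow_const 2))
          _ = liminf (fun i => ∫⁻ X in cellN N L, periodicInteraction (w m) L X *
                (‖(Ψ (ψ i)).ψ X‖₊ : ℝ≥0∞) ^ 2) atTop := by
              congr 1
              funext i
              exact lintegral_pot_formEmbed_trialState hL (Ψ (ψ i)) hWm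
      -- combine and use the near-minimising property along `ψ i ≥ m`
      set KINi : ℕ → ℝ≥0∞ := fun i => ∫⁻ X in cellN N L, kineticDensity (Ψ (ψ i)).ψ X with hKINi
      set POTi : ℕ → ℝ≥0∞ := fun i => ∫⁻ X in cellN N L, periodicInteraction (w m) L X *
          (‖(Ψ (ψ i)).ψ X‖₊ : ℝ≥0∞) ^ 2 with hPOTi
      have hsum : ∀ i, KINi i + POTi i = periodicEnergy (w m) (Ψ (ψ i)) := fun i => by
        simp only [hKINi, hPOTi, periodicEnergy]
        rw [← lintegral_add_left (measurable_kineticDensity_any (Ψ (ψ i)).ψ)]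
      have hev : ∀ᶠ i in atTop, KINi i + POTi i ≤ Einf + δ (ψ i) := by
        filter_upwards [hψ.tendsto_atTop.eventually (eventually_ge_atTop m)] with i hi
        rw [hsum i]
        exact (monotone_periodicEnergy_family hmono (Ψ (ψ i)) hi).trans (hΨ (ψ i)).le
      have hlim : Tendsto (fun i => Einf + δ (ψ i)) atTop (𝓝 Einf) := by
        have := (tendsto_const_nhds (x := Einf)).add (hδlim.comp hψ.tendsto_atTop)
        rwa [add_zero] at this
      calc _ ≤ liminf KINi atTop + liminf POTi atTop := add_le_add hkin hpot
        _ ≤ liminf (fun i => KINi i + POTi i) atTop := liminf_add_liminf_le KINi POTi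
        _ ≤ liminf (fun i => Einf + δ (ψ i)) atTop := liminf_le_liminf hev
        _ = Einf := hlim.liminf_eq
    -- Beppo Levi along the family
    have hmeas_m : ∀ m, AEMeasurable (fun t => periodicInteraction (w m) L (fromUnitTorusN L t) *
        (‖(η : UnitAddTorus (Fin N × Fin 3) → ℂ) t‖₊ : ℝ≥0∞) ^ 2) volume := fun m =>
      ((measurable_periodicInteraction_trunc (hwm m) L).comp
        (measurable_fromUnitTorusN L)).aemeasurable.mul
        ((Lp.aestronglyMeasurable η).aemeasurable.nnnorm.coe_nnreal_ennreal.pow_const 2)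
    have hsup' : ∫⁻ t, periodicInteraction v L (fromUnitTorusN L t) *
          (‖(η : UnitAddTorus (Fin N × Fin 3) → ℂ) t‖₊ : ℝ≥0∞) ^ 2 =
        ⨆ m, ∫⁻ t, periodicInteraction (w m) L (fromUnitTorusN L t) *
          (‖(η : UnitAddTorus (Fin N × Fin 3) → ℂ) t‖₊ : ℝ≥0∞) ^ 2 := by
      rw [← lintegral_iSup' hmeas_m (Eventually.of_forall fun t => fun m m' h => by
        dsimp only
        gcongr
        exact monotone_periodicInteraction_family hmono L _ h)]
      refine lintegral_congr fun t => ?_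
      rw [← ENNReal.iSup_mul, iSup_periodicInteraction_family hmono hsup]
    rw [hsup', ENNReal.add_iSup]
    exact iSup_le hm

/-- **Monotone convergence of the ground-state energies along an increasing family**: `⨆ₙ E₀(wₙ) = E₀(v)`
for `N ≥ 1`, `L > 0`, measurable profiles `w₀ ≤ w₁ ≤ … ↑ v` pointwise and a measurable `v` with integrable
interaction (`exists_limitProfile_family` and Simon's maximal-form bound `periodicGroundStateEnergy_le_maxForm`).
[cite: ReedSimonIV1978, Thm. XIII.64] -/
theorem iSup_periodicGroundStateEnergy_family (hv : Measurable v) (hN : 1 ≤ N) (hL : 0 < L)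
    (hW : ∫⁻ X in cellN N L, periodicInteraction v L X ≠ ⊤) (hwm : ∀ n, Measurable (w n))
    (hmono : ∀ r, Monotone fun n => w n r) (hsup : ∀ r, ⨆ n, w n r = v r) :
    ⨆ n : ℕ, periodicGroundStateEnergy (w n) N L = periodicGroundStateEnergy v N L := by
  refine le_antisymm (iSup_le fun n => periodicGroundStateEnergy_family_le hmono hsup n N L) ?_
  have hfin : periodicGroundStateEnergy v N L ≠ ⊤ := by
    obtain ⟨E₁, _, -, -, hE, -⟩ := exists_two_lowest_eigenvalues hL hv hW hN
    rw [hE]; exact ENNReal.ofReal_ne_top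
  have hsupfin : (⨆ n : ℕ, periodicGroundStateEnergy (w n) N L) ≠ ⊤ :=
    ne_top_of_le_ne_top hfin (iSup_le fun n => periodicGroundStateEnergy_family_le hmono hsup n N L)
  obtain ⟨η, hη1, hsymm, hQ⟩ := exists_limitProfile_family hwm hmono hsup hL hsupfin
  exact (periodicGroundStateEnergy_le_maxForm hL hv hW η hη1 hsymm).trans hQ

/-- **Registered sub-goal `stub_pfTruncFamily` of the crux item** (line `linear-ph-floor-wagner`, seat c2): monotone
convergence of the periodic ground-state energy along an increasing family of measurable profiles
(`iSup_periodicGroundStateEnergy_family`). [cite: ReedSimonIV1978, Thm. XIII.64] -/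
theorem stub_pfTruncFamily :
    ∀ {N : ℕ} {L : ℝ} {v : ℝ → ℝ≥0∞} {w : ℕ → ℝ → ℝ≥0∞}, Measurable v → 1 ≤ N → 0 < L → (∫⁻ X in cellN N L, periodicInteraction v L X) ≠ ⊤ → (∀ n, Measurable (w n)) → (∀ r, Monotone fun n => w n r) → (∀ r, ⨆ n, w n r = v r) → ⨆ n : ℕ, periodicGroundStateEnergy (w n) N L = periodicGroundStateEnergy v N L :=
  fun hv hN hL hW hwm hmono hsup => iSup_periodicGroundStateEnergy_family hv hN hL hW hwm hmono hsup

end Summit.AtomisticToContinuum.BoseEinsteinCondensation.Cruxes.PeriodicIRBound.LinearPhFloorWagner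

end
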